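import Literature.NumberTheory.Automorphic.KirillovWordExpansion
import Literature.NumberTheory.Automorphic.MixedSpaceMomentKernelsFourier
import Literature.NumberTheory.Automorphic.SmoothedVectorUnipotentDeriv
import Mathlib.Algebra.Order.Chebyshev
import HarnessLib

/-!
# The Kirillov `L²`-bound for `GL_2`, analytic half: dilation integrals of atoms and moments of smoothed vectors

Topic `NumberTheory/Automorphic`; namespace `Literature.NumberTheory.Automorphic`. Proof file
(theorems only). The two analytic estimates that turn the word expansion
(`KirillovWordExpansion`) into an `L²`-bound along the archimedean torus (Jacquet–Shalika (1981),
§4; the `GL_2(ℝ)` Kirillov model, Bump (1997), §2.8), for a closed subrepresentation `W ≤ L²`,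
`f ∈ W`, a test function `θ`:

* `lintegral_placeWeight_spectralMeasure_smoothedVector_le` — **polynomial moments of the
  `N_∞`-spectral measure of a smoothed vector**: for exponents `m` with `S = ∑_w m_w ≥ 1`,
  `∫ ∏_w |ξ_w|^{2m_w} dμ_{S_θ f}(ξ) ≤ A_S ∑_{e ∈ coordDirs} ‖S_{θ_{X_e^S}} f‖²`
  (`|ξ_w| ≤ ‖ξ‖ ≤ 3(2π)⁻¹ ∑_e |B(ξ,e)|`, Jensen, and the moment inequality
  `UnitaryRep.lintegral_pow_abs_bilin_le_of_norm_iterDiff_le` fed with the difference bounds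
  `norm_iterDiff_smoothedVector_le`); for `S = 0` the moment is `‖S_θ f‖²`
  (`lintegral_placeWeight_zero_spectralMeasure`);
* `lintegral_placeWeight_mul_norm_sq_smoothedVector_dilAtom_le` — **the dilation integral of an
  atom**: for a moment kernel `g` of order `k ≥ m + 1`,
  `∫_{K_∞ˣ} ∏_w |y_w|^{2m_w} ‖S_{g ⋆ L_{a(y)} θ} f‖² d^×y ≤ C(g, m) ∫ ∏_w |ξ_w|^{2m_w} dμ_{S_θ f}(ξ)`
  with `C(g, m) = ∫_{K_∞ˣ} ∏|z_w|^{2m_w} |ĝ(z⁻¹)|² d^×z < ∞` (`lintegral_weight_mul_norm_sq_kirillovKernel_le`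
  with `S_{g ⋆ L_{a(y)} θ} f = ∫ g(x) U_x R(a(y)) S_θ f dx`, the vanishing of `ĝ` at non-units and
  the finiteness of the constant, `MixedSpaceMomentKernelsFourier`).

## References

* H. Jacquet, J. A. Shalika, *On Euler products and the classification of automorphic
  representations I*, Amer. J. Math. 103 (1981), §4 [JacquetShalikaAJM1981].
* D. Bump, *Automorphic Forms and Representations* (1997), §2.8 [Bump1997].
* G. B. Folland, *A course in abstract harmonic analysis* (1995), Thm. 4.44 [Folland1995].
-/

noncomputable section

open scoped MatrixGroups Classical ENNReal NNReal InnerProductSpace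
open NumberField NumberField.mixedEmbedding NumberField.InfinitePlace IsDedekindDomain MeasureTheory Complex
open Literature.Analysis.UnboundedOperators Real

namespace Literature.NumberTheory.Automorphic

variable {K : Type} [Field K] [NumberField K]
  (hcpt : isCompact_glFiniteIntegralLevel 2 K)
  {μ : Measure (AdelicGroupData.gl 2 K).automorphicQuotient} [(AdelicGroupData.gl 2 K).IsAutomorphicMeasure μ]

attribute [local instance] adelicBorel borelSpace_adelic locallyCompactSpace_adelic
  secondCountableTopology_gl_adelic

attribute [local instance] Literature.MeasureTheory.Group.Units.borelSpace_of_isOpenEmbedding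
  Literature.MeasureTheory.Group.hasSummableGeomSeries_of_finiteDimensional

set_option backward.isDefEq.respectTransparency false
set_option synthInstance.maxHeartbeats 400000

attribute [local instance 100] LieRing.ofAssociativeRing

open scoped Matrix.Norms.Operator

variable (W : ContRepresentation.ClosedSubrep ((AdelicGroupData.gl 2 K).rightRegular μ))

/-! ### Polynomial weights against the character form -/

/-- The place weight is dominated by a power of the sup norm: `∏_w |ξ_w|^{2 m_w} ≤ ‖ξ‖^{2 ∑ m}`. [folklore] -/
theorem prod_normAtPlace_pow_le_norm_pow (m : InfinitePlace K → ℕ) (ξ : mixedSpace K) :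
    ∏ w, normAtPlace w ξ ^ (2 • m) w ≤ ‖ξ‖ ^ (2 * ∑ w, m w) := by
  calc ∏ w, normAtPlace w ξ ^ (2 • m) w ≤ ∏ w, ‖ξ‖ ^ (2 • m) w :=
        Finset.prod_le_prod (fun w _ => pow_nonneg (normAtPlace_nonneg _ _) _)
          fun w _ => pow_le_pow_left₀ (normAtPlace_nonneg _ _) (normAtPlace_le_norm K w ξ) _
    _ = ‖ξ‖ ^ (2 * ∑ w, m w) := by
        rw [Finset.prod_pow_eq_pow_sum, Finset.mul_sum]
        rfl

/-- **Place weights against the character form**: for `S = ∑_w m_w ≥ 1`,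
`∏_w |ξ_w|^{2m_w} ≤ A^{2S} N^{2S-1} ∑_{e ∈ coordDirs} |B(ξ, e)|^{2S}`, `A = 3(2π)⁻¹`, `N = #coordDirs`.
[folklore] -/
theorem prod_normAtPlace_pow_le_sum_pow_abs_archCharForm (m : InfinitePlace K → ℕ) (hS : 1 ≤ ∑ w, m w) (ξ : mixedSpace K) :
    ∏ w, normAtPlace w ξ ^ (2 • m) w ≤
      (3 * (2 * π)⁻¹) ^ (2 * ∑ w, m w) * (((coordDirs K).card : ℝ) ^ (2 * ∑ w, m w - 1) *
        ∑ e ∈ coordDirs K, |archCharForm K ξ e| ^ (2 * ∑ w, m w)) := by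
  obtain ⟨n, hn⟩ : ∃ n, 2 * ∑ w, m w = n + 1 := ⟨2 * ∑ w, m w - 1, by omega⟩
  refine (prod_normAtPlace_pow_le_norm_pow m ξ).trans ?_
  have h1 : ‖ξ‖ ^ (2 * ∑ w, m w) ≤ (3 * (2 * π)⁻¹) ^ (2 * ∑ w, m w) * (∑ e ∈ coordDirs K, |archCharForm K ξ e|) ^ (2 * ∑ w, m w) := by
    rw [← mul_pow]
    exact pow_le_pow_left₀ (norm_nonneg _) (norm_le_sum_abs_archCharForm ξ) _
  refine h1.trans (mul_le_mul_of_nonneg_left ?_ (by positivity))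
  rw [hn, Nat.add_sub_cancel]
  exact pow_sum_le_card_mul_sum_pow (fun e _ => abs_nonneg _) n

/-! ### Moments of the spectral measure of a smoothed vector -/

/-- The spectral measure of a vector for the unipotent line and Tate's character form. [folklore] -/
abbrev lineSpectralMeasure (v : (AdelicGroupData.gl 2 K).L2 μ) : Measure (mixedSpace K) :=
  (archUnipotentRep μ).spectralMeasure (archCharForm K) archCharForm_nondegenerate v

/-- `∫ 1 dμ_v = ‖v‖²`: the moment of order zero. [folklore] -/
theorem lintegral_placeWeight_zero_spectralMeasure (v : (AdelicGroupData.gl 2 K).L2 μ) :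
    ∫⁻ ξ, placeWeight K (2 • (0 : InfinitePlace K → ℕ)) ξ ∂(lineSpectralMeasure (μ := μ) v) = ENNReal.ofReal (‖v‖ ^ 2) := by
  have h : ∀ ξ : mixedSpace K, placeWeight K (2 • (0 : InfinitePlace K → ℕ)) ξ = 1 := fun ξ => by simp [placeWeight]
  simp_rw [h]
  rw [lintegral_one, UnitaryRep.spectralMeasure_univ]

/-- **A single moment**: `∫ |B(ξ, e)|^{2S} dμ_{S_θ f}(ξ) ≤ ‖S_{θ_{X_e^S}} f‖²`. [cite: Folland1995, Thm. 4.44] -/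
theorem lintegral_pow_abs_archCharForm_spectralMeasure_smoothedVector_le {θ : GL (Fin 2) (AdeleRing (𝓞 K) K) → ℝ}
    (hθ : IsTestFunctionGL 2 K θ) (f : W.toSubmodule) (e : mixedSpace K) (S : ℕ) :
    ∫⁻ ξ, ENNReal.ofReal (|archCharForm K ξ e| ^ (2 * S)) ∂(lineSpectralMeasure (μ := μ) (smoothedVector W θ f : (AdelicGroupData.gl 2 K).L2 μ)) ≤
      ENNReal.ofReal (‖(smoothedVector W (wordDerivWeight (AutomorphyDatum.gl 2 K hcpt).ofArch
        (List.replicate S (unipotentLetter hcpt e)) θ) f : (AdelicGroupData.gl 2 K).L2 μ)‖ ^ 2) :=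
  (archUnipotentRep μ).lintegral_pow_abs_bilin_le_of_norm_iterDiff_le (archCharForm K) archCharForm_nondegenerate _ e S zero_lt_one
    fun t ht _ => by
      have h := norm_iterDiff_smoothedVector_le hcpt W e f t S hθ
      rw [abs_of_pos ht] at h
      rwa [mul_comm]

/-- **Polynomial moments of the spectral measure of a smoothed vector**: for `S = ∑_w m_w ≥ 1`,
`∫ ∏_w |ξ_w|^{2m_w} dμ_{S_θ f} ≤ A_S ∑_{e ∈ coordDirs} ‖S_{θ_{X_e^S}} f‖²` with
`A_S = (3(2π)⁻¹)^{2S} N^{2S-1}`. [cite: JacquetShalikaAJM1981, §4] -/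
theorem lintegral_placeWeight_spectralMeasure_smoothedVector_le {θ : GL (Fin 2) (AdeleRing (𝓞 K) K) → ℝ}
    (hθ : IsTestFunctionGL 2 K θ) (f : W.toSubmodule) (m : InfinitePlace K → ℕ) (hS : 1 ≤ ∑ w, m w) :
    ∫⁻ ξ, placeWeight K (2 • m) ξ ∂(lineSpectralMeasure (μ := μ) (smoothedVector W θ f : (AdelicGroupData.gl 2 K).L2 μ)) ≤
      ENNReal.ofReal ((3 * (2 * π)⁻¹) ^ (2 * ∑ w, m w) * ((coordDirs K).card : ℝ) ^ (2 * ∑ w, m w - 1)) *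
        ∑ e ∈ coordDirs K, ENNReal.ofReal (‖(smoothedVector W (wordDerivWeight (AutomorphyDatum.gl 2 K hcpt).ofArch
          (List.replicate (∑ w, m w) (unipotentLetter hcpt e)) θ) f : (AdelicGroupData.gl 2 K).L2 μ)‖ ^ 2) := by
  set S := ∑ w, m w with hSdef
  set A : ℝ := (3 * (2 * π)⁻¹) ^ (2 * S) * ((coordDirs K).card : ℝ) ^ (2 * S - 1) with hA
  have hA0 : 0 ≤ A := by positivity
  set μv := lineSpectralMeasure (μ := μ) (smoothedVector W θ f : (AdelicGroupData.gl 2 K).L2 μ) with hμv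
  -- pointwise domination of the weight
  have hpt : ∀ ξ, placeWeight K (2 • m) ξ ≤ ENNReal.ofReal A * ∑ e ∈ coordDirs K, ENNReal.ofReal (|archCharForm K ξ e| ^ (2 * S)) := by
    intro ξ
    rw [placeWeight_eq_ofReal, ← ENNReal.ofReal_sum_of_nonneg fun e _ => pow_nonneg (abs_nonneg _) _, ← ENNReal.ofReal_mul hA0]
    exact ENNReal.ofReal_le_ofReal (by simpa only [hA, mul_assoc] using prod_normAtPlace_pow_le_sum_pow_abs_archCharForm m hS ξ)
  have hcontB : ∀ e : mixedSpace K, Continuous fun ξ : mixedSpace K => archCharForm K ξ e := fun e => by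
    simp only [archCharForm_apply]
    exact continuous_const.mul ((mixedTrace K).continuous_of_finiteDimensional.comp (continuous_id.mul continuous_const))
  have hmeas : ∀ e ∈ coordDirs K, Measurable fun ξ : mixedSpace K => ENNReal.ofReal (|archCharForm K ξ e| ^ (2 * S)) := fun e _ =>
    ((continuous_abs.comp (hcontB e)).pow _).measurable.ennreal_ofReal
  calc ∫⁻ ξ, placeWeight K (2 • m) ξ ∂μv ≤ ∫⁻ ξ, ENNReal.ofReal A * ∑ e ∈ coordDirs K, ENNReal.ofReal (|archCharForm K ξ e| ^ (2 * S)) ∂μv :=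
        lintegral_mono hpt
    _ = ENNReal.ofReal A * ∑ e ∈ coordDirs K, ∫⁻ ξ, ENNReal.ofReal (|archCharForm K ξ e| ^ (2 * S)) ∂μv := by
        rw [lintegral_const_mul _ (Finset.measurable_sum _ hmeas), lintegral_finsetSum _ hmeas]
    _ ≤ ENNReal.ofReal A * ∑ e ∈ coordDirs K, ENNReal.ofReal (‖(smoothedVector W (wordDerivWeight (AutomorphyDatum.gl 2 K hcpt).ofArch
          (List.replicate S (unipotentLetter hcpt e)) θ) f : (AdelicGroupData.gl 2 K).L2 μ)‖ ^ 2) := by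
        gcongr with e he
        exact lintegral_pow_abs_archCharForm_spectralMeasure_smoothedVector_le hcpt W hθ f e S

/-! ### The dilation integral of an atom -/

/-- The unit weight `y ↦ ∏_w |y_w|^{2m_w}` on `K_∞ˣ` is measurable. [folklore] -/
theorem measurable_placeWeight_units (m : InfinitePlace K → ℕ) :
    Measurable fun y : (mixedSpace K)ˣ => placeWeight K m (y : mixedSpace K) :=
  (measurable_placeWeight m).comp Units.continuous_val.measurable

/-- **The smoothed vector of an atom is the unipotent smoothing of a torus translate**:
`S_{g ⋆ L_{a(y)} θ} f = ∫ g(x) U_x R(a(y)) S_θ f dx` in `L²`. [cite: JacquetShalikaAJM1981, §4] -/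
theorem coe_smoothedVector_dilAtom {g : mixedSpace K → ℝ} (hg : Continuous g) (hgs : HasCompactSupport g)
    {θ : GL (Fin 2) (AdeleRing (𝓞 K) K) → ℝ} (hθ : IsTestFunctionGL 2 K θ) (f : W.toSubmodule) (y : (mixedSpace K)ˣ) :
    (smoothedVector W (dilAtom g θ y) f : (AdelicGroupData.gl 2 K).L2 μ) =
      ∫ x, (g x : ℂ) • (AdelicGroupData.gl 2 K).rightRegular μ (archUnipotentAdelic K x)
        ((AdelicGroupData.gl 2 K).rightRegular μ (archDilationAdelic K y) (smoothedVector W θ f : (AdelicGroupData.gl 2 K).L2 μ)) := by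
  rw [dilAtom, coe_smoothedVector_archUnipotentConv W hg hgs (continuous_leftTranslateWeight hθ.continuous _)
    (hasCompactSupport_leftTranslateWeight hθ.hasCompactSupport _) f, coe_smoothedVector_leftTranslate W hθ.continuous hθ.hasCompactSupport]

/-- **The dilation integral of an atom**: for a moment kernel `g` with `k w ≥ m w + 1` at every place,
`∫_{K_∞ˣ} ∏_w |y_w|^{2m_w} ‖S_{g ⋆ L_{a(y)} θ} f‖² d^×y ≤ C(g, m) · ∫ ∏_w |ξ_w|^{2m_w} dμ_{S_θ f}(ξ)`,
`C(g, m) = ∫ ∏|z_w|^{2m_w} |ĝ(z⁻¹)|² d^×z < ∞`. [cite: JacquetShalikaAJM1981, §4] [cite: Folland1995, Thm. 4.44] -/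
theorem lintegral_placeWeight_mul_norm_sq_smoothedVector_dilAtom_le {k m : InfinitePlace K → ℕ} {g : mixedSpace K → ℝ}
    (hg : IsMomentKernel K k g) (hkm : ∀ w, m w + 1 ≤ k w) {θ : GL (Fin 2) (AdeleRing (𝓞 K) K) → ℝ} (hθ : IsTestFunctionGL 2 K θ)
    (f : W.toSubmodule) :
    ∫⁻ y, placeWeight K (2 • m) (y : mixedSpace K) *
        ENNReal.ofReal (‖(smoothedVector W (dilAtom g θ y) f : (AdelicGroupData.gl 2 K).L2 μ)‖ ^ 2) ∂mixedUnitsHaar K ≤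
      (∫⁻ z, placeWeight K (2 • m) (z : mixedSpace K) *
          ENNReal.ofReal (‖kernelTransform K g (((z⁻¹ : (mixedSpace K)ˣ) : mixedSpace K))‖ ^ 2) ∂mixedUnitsHaar K) *
        ∫⁻ ξ, placeWeight K (2 • m) ξ ∂(lineSpectralMeasure (μ := μ) (smoothedVector W θ f : (AdelicGroupData.gl 2 K).L2 μ)) := by
  have hk1 : ∀ w, 1 ≤ k w := fun w => le_trans (Nat.le_add_left 1 (m w)) (hkm w)
  have hgi : Integrable (fun x => (g x : ℂ)) (volume : Measure (mixedSpace K)) :=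
    (hg.continuous.integrable_of_hasCompactSupport hg.hasCompactSupport).ofReal
  have h := lintegral_weight_mul_norm_sq_kirillovKernel_le (μ := μ) (smoothedVector W θ f : (AdelicGroupData.gl 2 K).L2 μ)
    (mixedUnitsHaar K) (fun y => placeWeight K (2 • m) (y : mixedSpace K)) (measurable_placeWeight_units (2 • m))
    (fun y z => by rw [Units.val_mul, placeWeight_mul]) (placeWeight K (2 • m)) (measurable_placeWeight (2 • m))
    (fun y ξ => placeWeight_mul (2 • m) _ ξ) (placeWeight_one (2 • m)) (volume : Measure (mixedSpace K)) hgi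
    (fun ξ hξ => hg.kernelTransform_eq_zero_of_not_isUnit hk1 hξ)
  simp_rw [coe_smoothedVector_dilAtom W hg.continuous hg.hasCompactSupport hθ f]
  simpa only [kernelTransform_eq] using h

end Literature.NumberTheory.Automorphic
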